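import Summits.BirchSwinnertonDyer.Rank1Residual.X11b.UnrSeriesValueRigidity
import HarnessLib

/-!
# X11b — VALUE-AT-𝟙 RIGIDITY ACROSS PERIODS (S27 'V1RIG'): two BDP frames
# `IsBDPLFunction ι 𝔭 κ γ f Ω_K Ω_p L`, `IsBDPLFunction ι 𝔭 κ γ f Ω_K' Ω_p' L'` of the SAME
# `(ι, 𝔭, κ, γ, f)` have THE SAME value at the trivial character, `[T⁰]L' = [T⁰]L`, given a character
# supply accumulating at `𝟙` — at every prime `p`

HONEST FRAMING (cell `b2b-bsdres`, run/shared/lean/b2b/bsd-rank1-residual/, verbatim in every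
file): the goal of the cell is to DELETE the COMBINATION-SHAPED residual classes of the
Birch–Swinnerton-Dyer formula for ALL analytic-rank `≤ 1` elliptic curves over `ℚ` — "full BSD
formula for every rank `≤ 1` curve in class `C`" assembled STRICTLY from published theorems — so
that the rank-`≤ 1` remainder becomes exactly the CONSTRUCTION-SHAPED classes, which are TYPED
(missing-input `Prop`s), NOT attempted. This is not "finishing BSD". Team `x11b3` (N8/O2), deal S27
'V1RIG' (x11b3-lead GEN 7 R8-14 (e)): STEP 1 typing = route planner 1's sketch
`HOME/b2b-bsdres-x11b3-r1/V1RIG-SKETCH.lean` (sha16 9d18b197ebdae999; statement §2, rescale lemmas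
§1); STEP 2 = this file + `X11b/UnrSeriesValueRigidity.lean` (seat `b2b-bsdres-x11b3-p3`). THEOREMS ONLY (no definition, no named fact,
no `sorry`); valid at every prime `p`; nothing here changes a label; H2 at `3 ‖ N` is not in print and
is NOT discharged by this file; the cross-period rigidity of H3 (divisibility) is NOT claimed.

## Why this file

`X11b/BDPFrameUniqueness.lean` (multr1-p1 gen 22) proved frame rigidity AT FIXED PERIODS: two `L`
with the same interpolation data `IsBDPLFunction ι 𝔭 κ γ f Ω_K Ω_p ·` coincide, and said: "frames
with DIFFERENT periods `(Ω_K, Ω_p) ≠ (Ω_K', Ω_p')` are not compared (their `L` differ by the factor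
`n ↦ (ι⁻¹(Ω_K/Ω_K')·Ω_p'/Ω_p)^{4n}` on the interpolation range, which need not come from a unit of
`R₀⟦T⟧`)". The cell's typed open inputs at `3` are ∀-FRAME (`Three.BDPValueAt₃ W`: EVERY frame's `L`
has the value `u·((1 − a₃ 3⁻¹)·log_ω P)²` at `𝟙`), while print (Castella 2018 Thm. 3.2, at `p ≥ 5`,
`p ∤ N`) and the ∃∧-typed facts speak of ONE frame. This file closes the currency gap FOR THE VALUE AT
`𝟙`: across frames of the same `(ι, 𝔭, κ, γ, f)` the value at the trivial character is THE SAME element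
of `R₀` — however the periods are chosen —, provided a CHARACTER SUPPLY accumulating at `𝟙` exists
(a hypothesis, as in `isBDPLFunction_unique_of_tendsto`; in nature: the powers `φ₀^{m p^k}`,
`φ₀^{2 m p^k}` of one unramified anticyclotomic character of infinity type `(1, −1)`).

## What is proved

* §1 (any `p`) route planner 1's RESCALING lemmas (her V1RIG-SKETCH §1, proved there; ported verbatim):
  `bdpInterpolationValue_rescale`, `frameValue_rescale`, `hasValueAt_frame_rescale` — at an
  interpolation point of type `(n, −n)` the second frame takes the first frame's value times `β^n`,
  `β := ι⁻¹((Ω_K/Ω_K')⁴)·(Ω_p'/Ω_p)⁴`.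
* §2 (any `p`) **`constantCoeff_eq_of_isBDPLFunction_of_supply`** — the S27 STATEMENT OF RECORD
  (route planner 1's §2, binders VERBATIM): two frames + a supply `(φ_k, m p^k, r_k)`,
  `(φ'_k, 2 m p^k, r'_k)` with avatar values `x₀^{p^k} → 1`, `x₀^{p^k} ≠ 1` (not used by the proof),
  `x₀^{2 p^k}` ⟹ `[T⁰]L' = [T⁰]L`. Proof: the ABSTRACT CORE
  `Halves.constantCoeff_eq_of_values_mul_sq` of `X11b/UnrSeriesValueRigidity.lean` (continuity of
  evaluation at `𝟙`, the limits `a_k → ρ`, `a_k² → ρ`, `ρ² = ρ`, and the order lemma excluding `ρ = 0`;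
  no identity principle, no rate estimate) with `T_k := x₀^{p^k} − 1 → 0`, `a_k := β^{m p^k}`
  (`x₀^{2p^k} − 1 = T_k (T_k + 2)`, `β^{2 m p^k} = a_k²`).

The `p = 3` readings (LW-H12FRAME; ∀-frame H2 `Three.BDPValueAt₃ W` from the ∃∧ input + supply, with
the S27 binder DISCHARGED) are the companion file `X11b/Three/BDPValueRigidityReading.lean`. Nothing
is booked; no mark / label / count moves.

References: [Castella2018] Thm. 3.1–3.2 (arXiv:1704.06608 pp. 8–9); [CastellaHsieh2018] §3.3,
Def. 3.5, Prop. 3.6; [Cassels1986] Ch. 4 (values of power series on the open disc).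
-/

noncomputable section

open scoped Classical Topology

open Filter WeierstrassCurve NumberField IsDedekindDomain Field PowerSeries
  Literature.NumberTheory.EllipticCurves Literature.NumberTheory.GaloisRepresentations

/-! ### §1 Period rescaling (route planner 1's V1RIG-SKETCH §1, ported verbatim): the frames' values differ by `β^n` -/


namespace Summit.BirchSwinnertonDyer.Rank1Residual.X11b

variable {p : ℕ} [Fact p.Prime]

section Rescale

variable {K : Type} [Field K] [NumberField K] {N : ℕ}

omit [Fact p.Prime] in
/-- **Complex period rescaling.** `bdpInterpolationValue … Ω_K = X(f, φ, n)/(π^(2n+1)·Ω_K^(4n))` with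
`X` independent of `Ω_K`; hence for `Ω_K, Ω_K' ≠ 0` the value at `Ω_K'` is the value at `Ω_K` times
`(Ω_K/Ω_K')^(4n)`. (Route planner 1's V1RIG-SKETCH §1(a).) [cite: Castella2018, Thm. 3.1 (arXiv:1704.06608 p. 9)] -/
theorem bdpInterpolationValue_rescale (f : CuspForm (CongruenceSubgroup.Gamma0 N) 2)
    (𝔭 : HeightOneSpectrum (𝓞 K)) (φ : HeckeCharacter K) (n : ℕ) {ΩK ΩK' : ℂ} (hΩK : ΩK ≠ 0)
    (hΩK' : ΩK' ≠ 0) :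
    bdpInterpolationValue p f 𝔭 φ n ΩK' =
      bdpInterpolationValue p f 𝔭 φ n ΩK * (ΩK / ΩK') ^ (4 * n) := by
  have h1 : ΩK ^ (4 * n) ≠ 0 := pow_ne_zero _ hΩK
  have h2 : ΩK' ^ (4 * n) ≠ 0 := pow_ne_zero _ hΩK'
  have hπ : (Real.pi : ℂ) ^ (2 * n + 1) ≠ 0 :=
    pow_ne_zero _ (Complex.ofReal_ne_zero.mpr Real.pi_ne_zero)
  simp only [bdpInterpolationValue]
  rw [div_pow]
  field_simp

/-- **The `ℂ_p`-values of two frames differ by `β ^ n`**, `β := ι⁻¹((Ω_K/Ω_K')⁴)·(Ω_p'/Ω_p)⁴`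
(independent of `φ`, `n`): `ι⁻¹(value(Ω_K'))·Ω_p'^(4n) = (ι⁻¹(value(Ω_K))·Ω_p^(4n))·β^n`.
(Route planner 1's V1RIG-SKETCH §1(b).) [cite: Castella2018, Thm. 3.1 (arXiv:1704.06608 p. 9)] -/
theorem frameValue_rescale (ι : PadicAlgCl p ≃+* ℂ) (f : CuspForm (CongruenceSubgroup.Gamma0 N) 2)
    (𝔭 : HeightOneSpectrum (𝓞 K)) (φ : HeckeCharacter K) (n : ℕ) {ΩK ΩK' : ℂ} (hΩK : ΩK ≠ 0)
    (hΩK' : ΩK' ≠ 0) {Ωp : ℂ_[p]} (Ωp' : ℂ_[p]) (hΩp : Ωp ≠ 0) :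
    ((ι.symm (bdpInterpolationValue p f 𝔭 φ n ΩK') : PadicAlgCl p) : ℂ_[p]) * Ωp' ^ (4 * n) =
      ((ι.symm (bdpInterpolationValue p f 𝔭 φ n ΩK) : PadicAlgCl p) : ℂ_[p]) * Ωp ^ (4 * n) *
        (((ι.symm ((ΩK / ΩK') ^ 4) : PadicAlgCl p) : ℂ_[p]) * (Ωp' / Ωp) ^ 4) ^ n := by
  rw [bdpInterpolationValue_rescale f 𝔭 φ n hΩK hΩK']
  have h3 : Ωp ^ (4 * n) ≠ 0 := pow_ne_zero _ hΩp
  simp only [PadicComplex.coe_eq]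
  rw [map_mul, map_mul]
  have hQ : (algebraMap (PadicAlgCl p) ℂ_[p]) (ι.symm ((ΩK / ΩK') ^ (4 * n))) =
      (algebraMap (PadicAlgCl p) ℂ_[p]) (ι.symm ((ΩK / ΩK') ^ 4)) ^ n := by
    rw [← map_pow, ← map_pow, ← pow_mul]
  rw [hQ]
  generalize (algebraMap (PadicAlgCl p) ℂ_[p]) (ι.symm ((ΩK / ΩK') ^ 4)) = B
  rw [mul_pow, ← pow_mul, div_pow]
  field_simp

/-- **At an interpolation point the second frame takes the first frame's value times `β^n`.**
(Route planner 1's V1RIG-SKETCH §1(c).) [cite: Castella2018, Thm. 3.1 (arXiv:1704.06608 p. 9)] -/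
theorem hasValueAt_frame_rescale {ι : PadicAlgCl p ≃+* ℂ} {𝔭 : HeightOneSpectrum (𝓞 K)}
    {κ : ZpExtension K p} {γ : Field.absoluteGaloisGroup K}
    {f : CuspForm (CongruenceSubgroup.Gamma0 N) 2} {ΩK ΩK' : ℂ} {Ωp Ωp' : ℂ_[p]} {L' : UnrSeries p}
    (hΩK : ΩK ≠ 0) (hΩK' : ΩK' ≠ 0) (hΩp : Ωp ≠ 0) (hL' : IsBDPLFunction ι 𝔭 κ γ f ΩK' Ωp' L')
    {φ : HeckeCharacter K} {n : ℕ} {r : FramedGaloisRep K (PadicAlgCl p) 1} (hn : 0 < n)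
    (hunr : ∀ v : HeightOneSpectrum (𝓞 K), φ.IsUnramifiedAt v)
    (hinf : φ.HasInfinityType (fun _ ↦ (n : ℤ)) (fun _ ↦ -(n : ℤ)))
    (hr : IsPAdicAvatarOf ι φ r) (hκ : FactorsThroughZp κ r) :
    L'.HasValueAt (avatarValueAt r γ - 1)
      (((ι.symm (bdpInterpolationValue p f 𝔭 φ n ΩK) : PadicAlgCl p) : ℂ_[p]) * Ωp ^ (4 * n) *
        (((ι.symm ((ΩK / ΩK') ^ 4) : PadicAlgCl p) : ℂ_[p]) * (Ωp' / Ωp) ^ 4) ^ n) := by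
  rw [← frameValue_rescale ι f 𝔭 φ n hΩK hΩK' Ωp' hΩp]
  exact hL'.hasValueAt hn hunr hinf hr hκ

end Rescale

end Summit.BirchSwinnertonDyer.Rank1Residual.X11b

/-! ### §2 The S27 statement of record: value-at-𝟙 rigidity across periods -/

namespace Summit.BirchSwinnertonDyer.Rank1Residual.X11b

open Summit.BirchSwinnertonDyer.Rank1Residual.X11b.Halves

variable {p : ℕ} [Fact p.Prime]

/-- **S27 'V1RIG' — VALUE-AT-𝟙 RIGIDITY ACROSS PERIODS** (route planner 1's V1RIG-SKETCH §2, binders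
VERBATIM; any prime `p`). For two frames `IsBDPLFunction ι 𝔭 κ γ f Ω_K Ω_p L`,
`IsBDPLFunction ι 𝔭 κ γ f Ω_K' Ω_p' L'` of the SAME `(ι, 𝔭, κ, γ, f)` with `Ω_K, Ω_K' ≠ 0`,
`Ω_p, Ω_p' ≠ 0`, and a CHARACTER SUPPLY at `(ι, κ, γ)` — `m > 0`, `x₀ ∈ ℂ_p` with `x₀^(p^k) → 1`
(and `x₀^(p^k) ≠ 1`, not used by the proof), and for every `k` interpolation data `(φ_k, m·p^k, r_k)`,
`(φ'_k, 2m·p^k, r'_k)` (unramified, of the displayed infinity types, with avatars through `κ`) with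
avatar values `x₀^(p^k)`, `x₀^(2·p^k)` at `γ` — one has `[T⁰]L' = [T⁰]L` in `R₀`: THE VALUE AT THE
TRIVIAL CHARACTER DOES NOT SEE THE PERIODS. (The series differ: `L'(T_φ) = β^n·L(T_φ)`,
`β := ι⁻¹((Ω_K/Ω_K')⁴)·(Ω_p'/Ω_p)⁴`, `hasValueAt_frame_rescale`.) Proof: the abstract core
`Halves.constantCoeff_eq_of_values_mul_sq` with `T_k := x₀^(p^k) − 1 → 0`, `a_k := β^(m p^k)`
(`x₀^(2p^k) − 1 = T_k (T_k + 2)`, `β^(2 m p^k) = a_k²`). The supply is a HYPOTHESIS (in nature: the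
powers `φ₀^{m p^k}`, `φ₀^{2 m p^k}` of one unramified character of infinity type `(1, −1)`; the tree
does not construct Hecke characters of prescribed type). Nothing booked; H2 / H3 at `3` untouched.
[cite: Castella2018, Thm. 3.1–3.2 (arXiv:1704.06608 pp. 8–9) (interpolation shape; the rigidity statement is elementary p-adic analysis on R₀⟦T⟧)]
[cite: CastellaHsieh2018, §3.3, Def. 3.5 and Prop. 3.6] -/
theorem constantCoeff_eq_of_isBDPLFunction_of_supply (K : Type) [Field K] [NumberField K] (N : ℕ)
    (ι : PadicAlgCl p ≃+* ℂ) (𝔭 : HeightOneSpectrum (𝓞 K)) (κ : ZpExtension K p)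
    (γ : Field.absoluteGaloisGroup K) (f : CuspForm (CongruenceSubgroup.Gamma0 N) 2) (ΩK ΩK' : ℂ)
    (Ωp Ωp' : ℂ_[p]) (L L' : UnrSeries p) (m : ℕ) (x₀ : ℂ_[p]) (φ φ' : ℕ → HeckeCharacter K)
    (r r' : ℕ → FramedGaloisRep K (PadicAlgCl p) 1)
    (hm : 0 < m) (_hx1 : ∀ k, x₀ ^ p ^ k ≠ 1) (hx : Tendsto (fun k ↦ x₀ ^ p ^ k) atTop (𝓝 1))
    (hunr : ∀ k (v : HeightOneSpectrum (𝓞 K)), (φ k).IsUnramifiedAt v)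
    (hinf : ∀ k, (φ k).HasInfinityType (fun _ ↦ ((m * p ^ k : ℕ) : ℤ))
      (fun _ ↦ -((m * p ^ k : ℕ) : ℤ)))
    (hr : ∀ k, IsPAdicAvatarOf ι (φ k) (r k)) (hrκ : ∀ k, FactorsThroughZp κ (r k))
    (hval : ∀ k, avatarValueAt (r k) γ = x₀ ^ p ^ k)
    (hunr' : ∀ k (v : HeightOneSpectrum (𝓞 K)), (φ' k).IsUnramifiedAt v)
    (hinf' : ∀ k, (φ' k).HasInfinityType (fun _ ↦ ((2 * m * p ^ k : ℕ) : ℤ))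
      (fun _ ↦ -((2 * m * p ^ k : ℕ) : ℤ)))
    (hr' : ∀ k, IsPAdicAvatarOf ι (φ' k) (r' k)) (hrκ' : ∀ k, FactorsThroughZp κ (r' k))
    (hval' : ∀ k, avatarValueAt (r' k) γ = x₀ ^ (2 * p ^ k))
    (hΩK : ΩK ≠ 0) (hΩK' : ΩK' ≠ 0) (hΩp : Ωp ≠ 0) (hΩp' : Ωp' ≠ 0)
    (hL : IsBDPLFunction ι 𝔭 κ γ f ΩK Ωp L) (hL' : IsBDPLFunction ι 𝔭 κ γ f ΩK' Ωp' L') :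
    PowerSeries.constantCoeff L' = PowerSeries.constantCoeff L := by
  have hp : p.Prime := Fact.out
  -- the points `T_k = x₀^(p^k) − 1 → 0`
  set T : ℕ → ℂ_[p] := fun k ↦ x₀ ^ p ^ k - 1 with hT
  have hT0 : Tendsto T atTop (𝓝 0) := by
    have h := hx.sub_const 1
    rwa [sub_self] at h
  -- the period ratio `β` and the factors `a_k = β^(m p^k) ≠ 0`
  set β : ℂ_[p] := ((ι.symm ((ΩK / ΩK') ^ 4) : PadicAlgCl p) : ℂ_[p]) * (Ωp' / Ωp) ^ 4 with hβ
  have hβ0 : β ≠ 0 := by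
    refine mul_ne_zero ?_ (pow_ne_zero _ (div_ne_zero hΩp' hΩp))
    rw [PadicComplex.coe_eq]
    exact (map_ne_zero_iff _ (algebraMap (PadicAlgCl p) ℂ_[p]).injective).mpr
      ((map_ne_zero_iff _ ι.symm.injective).mpr (pow_ne_zero _ (div_ne_zero hΩK hΩK')))
  set a : ℕ → ℂ_[p] := fun k ↦ β ^ (m * p ^ k) with ha
  have ha0 : ∀ k, a k ≠ 0 := fun k ↦ pow_ne_zero _ hβ0
  -- exponents are positive
  have hn : ∀ k, 0 < m * p ^ k := fun k ↦ Nat.mul_pos hm (pow_pos hp.pos k)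
  have hn' : ∀ k, 0 < 2 * m * p ^ k := fun k ↦ Nat.mul_pos (Nat.mul_pos two_pos hm) (pow_pos hp.pos k)
  -- the second supply's points are `T_k (T_k + 2)`
  have hT' : ∀ k, x₀ ^ (2 * p ^ k) - 1 = T k * (T k + 2) := by
    intro k
    simp only [hT]
    ring
  -- values of the first frame
  set v : ℕ → ℂ_[p] := fun k ↦
    ((ι.symm (bdpInterpolationValue p f 𝔭 (φ k) (m * p ^ k) ΩK) : PadicAlgCl p) : ℂ_[p]) *
      Ωp ^ (4 * (m * p ^ k)) with hv
  set w : ℕ → ℂ_[p] := fun k ↦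
    ((ι.symm (bdpInterpolationValue p f 𝔭 (φ' k) (2 * m * p ^ k) ΩK) : PadicAlgCl p) : ℂ_[p]) *
      Ωp ^ (4 * (2 * m * p ^ k)) with hw
  have hLv : ∀ k, L.HasValueAt (T k) (v k) := by
    intro k
    have h := hL.hasValueAt (hn k) (hunr k) (hinf k) (hr k) (hrκ k)
    rwa [hval k] at h
  have hLw : ∀ k, L.HasValueAt (T k * (T k + 2)) (w k) := by
    intro k
    have h := hL.hasValueAt (hn' k) (hunr' k) (hinf' k) (hr' k) (hrκ' k)
    rwa [hval' k, hT' k] at h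
  -- values of the second frame, tied by `a_k` and `a_k²`
  have hL'v : ∀ k, L'.HasValueAt (T k) (a k * v k) := by
    intro k
    have h := hasValueAt_frame_rescale hΩK hΩK' hΩp hL' (hn k) (hunr k) (hinf k) (hr k) (hrκ k)
    have hvals : ((ι.symm (bdpInterpolationValue p f 𝔭 (φ k) (m * p ^ k) ΩK) : PadicAlgCl p) :
        ℂ_[p]) * Ωp ^ (4 * (m * p ^ k)) *
        (((ι.symm ((ΩK / ΩK') ^ 4) : PadicAlgCl p) : ℂ_[p]) * (Ωp' / Ωp) ^ 4) ^ (m * p ^ k) =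
        a k * v k := by
      simp only [ha, hv, hβ]
      ring
    rw [hval k, hvals] at h
    exact h
  have hL'w : ∀ k, L'.HasValueAt (T k * (T k + 2)) (a k ^ 2 * w k) := by
    intro k
    have h := hasValueAt_frame_rescale hΩK hΩK' hΩp hL' (hn' k) (hunr' k) (hinf' k) (hr' k)
      (hrκ' k)
    have hvals : ((ι.symm (bdpInterpolationValue p f 𝔭 (φ' k) (2 * m * p ^ k) ΩK) :
        PadicAlgCl p) : ℂ_[p]) * Ωp ^ (4 * (2 * m * p ^ k)) *
        (((ι.symm ((ΩK / ΩK') ^ 4) : PadicAlgCl p) : ℂ_[p]) * (Ωp' / Ωp) ^ 4) ^ (2 * m * p ^ k) =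
        a k ^ 2 * w k := by
      simp only [ha, hw, hβ]
      ring
    rw [hval' k, hT' k, hvals] at h
    exact h
  exact Halves.constantCoeff_eq_of_values_mul_sq hT0 ha0 hLv hL'v hLw hL'w

end Summit.BirchSwinnertonDyer.Rank1Residual.X11b

end
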